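import Summits.Ventures.YMGap.RobustBall.StringTensionOnBallW
import Summits.Ventures.YMGap.RobustBall.AreaLawRowsSU3PV
import HarnessLib

/-!
# Venture YMGap, track Y2 ROBUST-BALL — `SU(3)` STRING TENSION ON THE BALL, HYPOTHESIS-FREE beyond `β_W = 1/3`: the infinite-volume reading of
# the Poincaré × Schwinger–Dyson area-law rows (`AreaLawRowsSU3PV`), `d = 4`, tiers 1 and 2

HONEST FRAMING.  Venture file of the cell `pub-ymgap` (QuantumFields programme), seat engine-2 (g9); 0 compute.  Strong-coupling LATTICE
statements only; nothing about the continuum, a spectral mass gap, weak coupling, or Clay.  rb-p2's `suFundStringTension_ge_onBall` /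
`suFundStringTension_ge_onBallW` (tree: every `N`; input an `AreaLawOnBall(W) N 4 β … ` row BY NAME) turn each TORUS area-law row into a statement about
every INFINITE-VOLUME LIMIT STATE `μ` of every eventually-member family `𝓦` of the ball (`perturbedLimitPoints β 𝓦`, non-empty by compactness): ONE pair
`(C, c)`, `c > 0`, with the `ℤ⁴` area law `HasAreaLawWith μ χ₃ C c` (`χ₃ = (1/3) Re tr`) and `c ≤ suFundStringTension 3 μ` WHENEVER the string tension of
`μ` exists (existence NOT asserted: a generic member is not reflection positive).  This file records the `SU(3)` HYPOTHESIS-FREE instances (class K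
outright) on this seat's PV pair-door rows `RobustBallPV.su3_pvRow4_*` / `su3_pvRowW4_*`:
* TIER 1 (`ClusterDomainFR (2ε) ε r`, every `r`, every `mv ≥ 1`), `(β_W; ε₀, ε₁)`: (1 / 4; .546, .273) (3 / 10; .406, .203) (1 / 3; .312, .156) (3 / 8; .194, .097) (2 / 5; .122, .061) (21 / 50; .064, .032) (43 / 100; .036, .018);
* TIER 2 (`ClusterDomain (log 6/5) (2ε) ε`, every `mv ≥ 1`): (1 / 4; .520, .260) (3 / 10; .376, .188) (1 / 3; .280, .140) (3 / 8; .160, .080) (2 / 5; .086, .043).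
WHAT MOVES: the hypothesis-free `SU(3)` string-tension-on-the-ball instances of `StringTensionOnBallSU3` / `StringTensionOnBallWSU3` (engine-2 g7, Bakry–Émery
pair) stopped at `β_W = 1/3` (tier 1; ball `(0.138, 0.069)`) resp. `1/4` (tier 2); here they reach `β_W = 43/100` (tier 1) and `2/5` (tier 2), with larger
balls at every common coupling (`1/4`: `(0.546, 0.273)` vs `(0.406, 0.203)`).  The CONDITIONAL instances (H1 ∧ H2, to `11/20` / `3/4`) are untouched.
-/

noncomputable section

open MeasureTheory Filter Topology
open Literature.MathematicalPhysics.QuantumLattice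
open Literature.MathematicalPhysics.QuantumFieldTheory hiding ZdEdge Site
open Literature.Barriers.QuantumFields (suFundStringTension)
open Summit.Ventures.YMGap.RobustBall

namespace Summit.Ventures.YMGap.RobustBallPV

/-! ### 1. Tier 1 (finite range), hypothesis-free -/

/-- **`SU(3)`, `d = 4`, `β_W = 1 / 4`, ball `(ε₀, ε₁) = (.546, .273)`, HYPOTHESIS-FREE: string tension on the ball** — one `c > 0` such that
every infinite-volume limit state `μ` of every eventually-member family satisfies `HasAreaLawWith μ χ₃ C c` and, whenever its string tension exists,
`c ≤ suFundStringTension 3 μ`.  Input: `su3_pvRow4_1_4`. [folklore] -/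
theorem su3_stringTension_onBall_pv_1_4 (r : ℕ) {mv : ℕ} (hmv : 1 ≤ mv) :
    ∃ C c : ℝ, 0 < c ∧ ∀ 𝓦 : PerturbationFamily 4 3,
      (∀ᶠ L : ℕ in atTop, 𝓦 L ∈ ClusterDomainFR (2 * (273 / 1000)) (273 / 1000) r ∧ IsSlabLocal mv (𝓦 L)) →
        ∀ μ ∈ perturbedLimitPoints ((1 / 4 : ℝ) / 3) 𝓦,
          HasAreaLawWith μ (fun g => normalisedCharacter 3 (fundamentalRep (Fin 3) g)) C c ∧
          ((∃ σ : ℝ, HasStringTension μ (fun g => normalisedCharacter 3 (fundamentalRep (Fin 3) g)) σ) →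
            c ≤ suFundStringTension 3 μ) :=
  suFundStringTension_ge_onBall (su3_pvRow4_1_4 r hmv)

/-- **`SU(3)`, `d = 4`, `β_W = 3 / 10`, ball `(ε₀, ε₁) = (.406, .203)`, HYPOTHESIS-FREE: string tension on the ball** — one `c > 0` such that
every infinite-volume limit state `μ` of every eventually-member family satisfies `HasAreaLawWith μ χ₃ C c` and, whenever its string tension exists,
`c ≤ suFundStringTension 3 μ`.  Input: `su3_pvRow4_3_10`. [folklore] -/
theorem su3_stringTension_onBall_pv_3_10 (r : ℕ) {mv : ℕ} (hmv : 1 ≤ mv) :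
    ∃ C c : ℝ, 0 < c ∧ ∀ 𝓦 : PerturbationFamily 4 3,
      (∀ᶠ L : ℕ in atTop, 𝓦 L ∈ ClusterDomainFR (2 * (203 / 1000)) (203 / 1000) r ∧ IsSlabLocal mv (𝓦 L)) →
        ∀ μ ∈ perturbedLimitPoints ((3 / 10 : ℝ) / 3) 𝓦,
          HasAreaLawWith μ (fun g => normalisedCharacter 3 (fundamentalRep (Fin 3) g)) C c ∧
          ((∃ σ : ℝ, HasStringTension μ (fun g => normalisedCharacter 3 (fundamentalRep (Fin 3) g)) σ) →
            c ≤ suFundStringTension 3 μ) :=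
  suFundStringTension_ge_onBall (su3_pvRow4_3_10 r hmv)

/-- **`SU(3)`, `d = 4`, `β_W = 1 / 3`, ball `(ε₀, ε₁) = (.312, .156)`, HYPOTHESIS-FREE: string tension on the ball** — one `c > 0` such that
every infinite-volume limit state `μ` of every eventually-member family satisfies `HasAreaLawWith μ χ₃ C c` and, whenever its string tension exists,
`c ≤ suFundStringTension 3 μ`.  Input: `su3_pvRow4_1_3`. [folklore] -/
theorem su3_stringTension_onBall_pv_1_3 (r : ℕ) {mv : ℕ} (hmv : 1 ≤ mv) :
    ∃ C c : ℝ, 0 < c ∧ ∀ 𝓦 : PerturbationFamily 4 3,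
      (∀ᶠ L : ℕ in atTop, 𝓦 L ∈ ClusterDomainFR (2 * (39 / 250)) (39 / 250) r ∧ IsSlabLocal mv (𝓦 L)) →
        ∀ μ ∈ perturbedLimitPoints ((1 / 3 : ℝ) / 3) 𝓦,
          HasAreaLawWith μ (fun g => normalisedCharacter 3 (fundamentalRep (Fin 3) g)) C c ∧
          ((∃ σ : ℝ, HasStringTension μ (fun g => normalisedCharacter 3 (fundamentalRep (Fin 3) g)) σ) →
            c ≤ suFundStringTension 3 μ) :=
  suFundStringTension_ge_onBall (su3_pvRow4_1_3 r hmv)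

/-- **`SU(3)`, `d = 4`, `β_W = 3 / 8`, ball `(ε₀, ε₁) = (.194, .097)`, HYPOTHESIS-FREE: string tension on the ball** — one `c > 0` such that
every infinite-volume limit state `μ` of every eventually-member family satisfies `HasAreaLawWith μ χ₃ C c` and, whenever its string tension exists,
`c ≤ suFundStringTension 3 μ`.  Input: `su3_pvRow4_3_8`. [folklore] -/
theorem su3_stringTension_onBall_pv_3_8 (r : ℕ) {mv : ℕ} (hmv : 1 ≤ mv) :
    ∃ C c : ℝ, 0 < c ∧ ∀ 𝓦 : PerturbationFamily 4 3,
      (∀ᶠ L : ℕ in atTop, 𝓦 L ∈ ClusterDomainFR (2 * (97 / 1000)) (97 / 1000) r ∧ IsSlabLocal mv (𝓦 L)) →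
        ∀ μ ∈ perturbedLimitPoints ((3 / 8 : ℝ) / 3) 𝓦,
          HasAreaLawWith μ (fun g => normalisedCharacter 3 (fundamentalRep (Fin 3) g)) C c ∧
          ((∃ σ : ℝ, HasStringTension μ (fun g => normalisedCharacter 3 (fundamentalRep (Fin 3) g)) σ) →
            c ≤ suFundStringTension 3 μ) :=
  suFundStringTension_ge_onBall (su3_pvRow4_3_8 r hmv)

/-- **`SU(3)`, `d = 4`, `β_W = 2 / 5`, ball `(ε₀, ε₁) = (.122, .061)`, HYPOTHESIS-FREE: string tension on the ball** — one `c > 0` such that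
every infinite-volume limit state `μ` of every eventually-member family satisfies `HasAreaLawWith μ χ₃ C c` and, whenever its string tension exists,
`c ≤ suFundStringTension 3 μ`.  Input: `su3_pvRow4_2_5`. [folklore] -/
theorem su3_stringTension_onBall_pv_2_5 (r : ℕ) {mv : ℕ} (hmv : 1 ≤ mv) :
    ∃ C c : ℝ, 0 < c ∧ ∀ 𝓦 : PerturbationFamily 4 3,
      (∀ᶠ L : ℕ in atTop, 𝓦 L ∈ ClusterDomainFR (2 * (61 / 1000)) (61 / 1000) r ∧ IsSlabLocal mv (𝓦 L)) →
        ∀ μ ∈ perturbedLimitPoints ((2 / 5 : ℝ) / 3) 𝓦,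
          HasAreaLawWith μ (fun g => normalisedCharacter 3 (fundamentalRep (Fin 3) g)) C c ∧
          ((∃ σ : ℝ, HasStringTension μ (fun g => normalisedCharacter 3 (fundamentalRep (Fin 3) g)) σ) →
            c ≤ suFundStringTension 3 μ) :=
  suFundStringTension_ge_onBall (su3_pvRow4_2_5 r hmv)

/-- **`SU(3)`, `d = 4`, `β_W = 21 / 50`, ball `(ε₀, ε₁) = (.064, .032)`, HYPOTHESIS-FREE: string tension on the ball** — one `c > 0` such that
every infinite-volume limit state `μ` of every eventually-member family satisfies `HasAreaLawWith μ χ₃ C c` and, whenever its string tension exists,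
`c ≤ suFundStringTension 3 μ`.  Input: `su3_pvRow4_21_50`. [folklore] -/
theorem su3_stringTension_onBall_pv_21_50 (r : ℕ) {mv : ℕ} (hmv : 1 ≤ mv) :
    ∃ C c : ℝ, 0 < c ∧ ∀ 𝓦 : PerturbationFamily 4 3,
      (∀ᶠ L : ℕ in atTop, 𝓦 L ∈ ClusterDomainFR (2 * (4 / 125)) (4 / 125) r ∧ IsSlabLocal mv (𝓦 L)) →
        ∀ μ ∈ perturbedLimitPoints ((21 / 50 : ℝ) / 3) 𝓦,
          HasAreaLawWith μ (fun g => normalisedCharacter 3 (fundamentalRep (Fin 3) g)) C c ∧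
          ((∃ σ : ℝ, HasStringTension μ (fun g => normalisedCharacter 3 (fundamentalRep (Fin 3) g)) σ) →
            c ≤ suFundStringTension 3 μ) :=
  suFundStringTension_ge_onBall (su3_pvRow4_21_50 r hmv)

/-- **`SU(3)`, `d = 4`, `β_W = 43 / 100`, ball `(ε₀, ε₁) = (.036, .018)`, HYPOTHESIS-FREE: string tension on the ball** — one `c > 0` such that
every infinite-volume limit state `μ` of every eventually-member family satisfies `HasAreaLawWith μ χ₃ C c` and, whenever its string tension exists,
`c ≤ suFundStringTension 3 μ`.  Input: `su3_pvRow4_43_100`. [folklore] -/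
theorem su3_stringTension_onBall_pv_43_100 (r : ℕ) {mv : ℕ} (hmv : 1 ≤ mv) :
    ∃ C c : ℝ, 0 < c ∧ ∀ 𝓦 : PerturbationFamily 4 3,
      (∀ᶠ L : ℕ in atTop, 𝓦 L ∈ ClusterDomainFR (2 * (9 / 500)) (9 / 500) r ∧ IsSlabLocal mv (𝓦 L)) →
        ∀ μ ∈ perturbedLimitPoints ((43 / 100 : ℝ) / 3) 𝓦,
          HasAreaLawWith μ (fun g => normalisedCharacter 3 (fundamentalRep (Fin 3) g)) C c ∧
          ((∃ σ : ℝ, HasStringTension μ (fun g => normalisedCharacter 3 (fundamentalRep (Fin 3) g)) σ) →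
            c ≤ suFundStringTension 3 μ) :=
  suFundStringTension_ge_onBall (su3_pvRow4_43_100 r hmv)

/-! ### 2. Tier 2 (diameter-weighted ball, `κ = log 6/5`), hypothesis-free -/

/-- **`SU(3)`, `d = 4`, `β_W = 1 / 4`, TIER-2 ball `ClusterDomain (log 6/5) (.520) (.260)`, HYPOTHESIS-FREE**: the same reading, from
`su3_pvRowW4_1_4`. [folklore] -/
theorem su3_stringTension_onBallW_pv_1_4 {mv : ℕ} (hmv : 1 ≤ mv) :
    ∃ C c : ℝ, 0 < c ∧ ∀ 𝓦 : PerturbationFamily 4 3,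
      (∀ᶠ L : ℕ in atTop, 𝓦 L ∈ ClusterDomain (Real.log (6 / 5)) (2 * (13 / 50)) (13 / 50) ∧ IsSlabLocal mv (𝓦 L)) →
        ∀ μ ∈ perturbedLimitPoints ((1 / 4 : ℝ) / 3) 𝓦,
          HasAreaLawWith μ (fun g => normalisedCharacter 3 (fundamentalRep (Fin 3) g)) C c ∧
          ((∃ σ : ℝ, HasStringTension μ (fun g => normalisedCharacter 3 (fundamentalRep (Fin 3) g)) σ) →
            c ≤ suFundStringTension 3 μ) :=
  suFundStringTension_ge_onBallW (su3_pvRowW4_1_4 hmv)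

/-- **`SU(3)`, `d = 4`, `β_W = 3 / 10`, TIER-2 ball `ClusterDomain (log 6/5) (.376) (.188)`, HYPOTHESIS-FREE**: the same reading, from
`su3_pvRowW4_3_10`. [folklore] -/
theorem su3_stringTension_onBallW_pv_3_10 {mv : ℕ} (hmv : 1 ≤ mv) :
    ∃ C c : ℝ, 0 < c ∧ ∀ 𝓦 : PerturbationFamily 4 3,
      (∀ᶠ L : ℕ in atTop, 𝓦 L ∈ ClusterDomain (Real.log (6 / 5)) (2 * (47 / 250)) (47 / 250) ∧ IsSlabLocal mv (𝓦 L)) →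
        ∀ μ ∈ perturbedLimitPoints ((3 / 10 : ℝ) / 3) 𝓦,
          HasAreaLawWith μ (fun g => normalisedCharacter 3 (fundamentalRep (Fin 3) g)) C c ∧
          ((∃ σ : ℝ, HasStringTension μ (fun g => normalisedCharacter 3 (fundamentalRep (Fin 3) g)) σ) →
            c ≤ suFundStringTension 3 μ) :=
  suFundStringTension_ge_onBallW (su3_pvRowW4_3_10 hmv)

/-- **`SU(3)`, `d = 4`, `β_W = 1 / 3`, TIER-2 ball `ClusterDomain (log 6/5) (.280) (.140)`, HYPOTHESIS-FREE**: the same reading, from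
`su3_pvRowW4_1_3`. [folklore] -/
theorem su3_stringTension_onBallW_pv_1_3 {mv : ℕ} (hmv : 1 ≤ mv) :
    ∃ C c : ℝ, 0 < c ∧ ∀ 𝓦 : PerturbationFamily 4 3,
      (∀ᶠ L : ℕ in atTop, 𝓦 L ∈ ClusterDomain (Real.log (6 / 5)) (2 * (7 / 50)) (7 / 50) ∧ IsSlabLocal mv (𝓦 L)) →
        ∀ μ ∈ perturbedLimitPoints ((1 / 3 : ℝ) / 3) 𝓦,
          HasAreaLawWith μ (fun g => normalisedCharacter 3 (fundamentalRep (Fin 3) g)) C c ∧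
          ((∃ σ : ℝ, HasStringTension μ (fun g => normalisedCharacter 3 (fundamentalRep (Fin 3) g)) σ) →
            c ≤ suFundStringTension 3 μ) :=
  suFundStringTension_ge_onBallW (su3_pvRowW4_1_3 hmv)

/-- **`SU(3)`, `d = 4`, `β_W = 3 / 8`, TIER-2 ball `ClusterDomain (log 6/5) (.160) (.080)`, HYPOTHESIS-FREE**: the same reading, from
`su3_pvRowW4_3_8`. [folklore] -/
theorem su3_stringTension_onBallW_pv_3_8 {mv : ℕ} (hmv : 1 ≤ mv) :
    ∃ C c : ℝ, 0 < c ∧ ∀ 𝓦 : PerturbationFamily 4 3,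
      (∀ᶠ L : ℕ in atTop, 𝓦 L ∈ ClusterDomain (Real.log (6 / 5)) (2 * (2 / 25)) (2 / 25) ∧ IsSlabLocal mv (𝓦 L)) →
        ∀ μ ∈ perturbedLimitPoints ((3 / 8 : ℝ) / 3) 𝓦,
          HasAreaLawWith μ (fun g => normalisedCharacter 3 (fundamentalRep (Fin 3) g)) C c ∧
          ((∃ σ : ℝ, HasStringTension μ (fun g => normalisedCharacter 3 (fundamentalRep (Fin 3) g)) σ) →
            c ≤ suFundStringTension 3 μ) :=
  suFundStringTension_ge_onBallW (su3_pvRowW4_3_8 hmv)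

/-- **`SU(3)`, `d = 4`, `β_W = 2 / 5`, TIER-2 ball `ClusterDomain (log 6/5) (.086) (.043)`, HYPOTHESIS-FREE**: the same reading, from
`su3_pvRowW4_2_5`. [folklore] -/
theorem su3_stringTension_onBallW_pv_2_5 {mv : ℕ} (hmv : 1 ≤ mv) :
    ∃ C c : ℝ, 0 < c ∧ ∀ 𝓦 : PerturbationFamily 4 3,
      (∀ᶠ L : ℕ in atTop, 𝓦 L ∈ ClusterDomain (Real.log (6 / 5)) (2 * (43 / 1000)) (43 / 1000) ∧ IsSlabLocal mv (𝓦 L)) →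
        ∀ μ ∈ perturbedLimitPoints ((2 / 5 : ℝ) / 3) 𝓦,
          HasAreaLawWith μ (fun g => normalisedCharacter 3 (fundamentalRep (Fin 3) g)) C c ∧
          ((∃ σ : ℝ, HasStringTension μ (fun g => normalisedCharacter 3 (fundamentalRep (Fin 3) g)) σ) →
            c ≤ suFundStringTension 3 μ) :=
  suFundStringTension_ge_onBallW (su3_pvRowW4_2_5 hmv)

end Summit.Ventures.YMGap.RobustBallPV

end
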